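import Summits.BirchSwinnertonDyer.BirchSwinnertonDyer.Theorems.PrintX8VerticalStevensIrreducible
import Summits.BirchSwinnertonDyer.BirchSwinnertonDyer.Theorems.PrintX9EvenBranchMuZeroInputFree
import Summits.BirchSwinnertonDyer.BirchSwinnertonDyer.Theorems.AlignedTransportAtTwoMainConjectureTransportAlignedAtTwoMuCertificate
import Summits.BirchSwinnertonDyer.BirchSwinnertonDyer.Theorems.PrintX10bAnalyticMuZeroX10bStubUnitMeasureOfNonconstancy
import Summits.BirchSwinnertonDyer.Rank1Residual.F1Sign2.BranchCongruenceModTwoAtTwo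
import Summits.BirchSwinnertonDyer.Rank1Residual.X5.TwoAdicTargetsAlphaAuto
import Summits.BirchSwinnertonDyer.BirchSwinnertonDyer.Theorems.ByReductionTypeAtTwoOrdIsogenyRescale
import Summits.BirchSwinnertonDyer.Rank1Residual.X5.TwoAdicTargetsMuGap
import Literature.NumberTheory.EllipticCurves.Rank1Residual.PeriodUnitProofs
import Literature.NumberTheory.EllipticCurves.ModularCurvePeriodRatio
import HarnessLib

/-!
# Crux `OrdMissingLowerBoundAtTwo` (stmt-BirchSwinnertonDyer-19577), crux idea `odd-winding-class-at-two` —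
# SKETCH (ideator 2/2, gen 5): the INPUT-FREE `p`-odd chain «THEOREM B ⇒ ℓ-Hecke bridge ⇒ collapse ⇒ even branch»
# (tree: `PrintX9EvenBranchMuZeroInputFree`, at `p = 3` = Greenberg's analytic `μ₃ = 0`) PORTED TO `p = 2` on the
# good-ordinary, `E(ℚ)[2] = 0` locus, with the plus symbol DOUBLED (`2[·]⁺ ∈ ℤ₍₂₎`).

HONEST FRAMING. BSD is NOT proved here; the crux 19577 is NOT closed here; `F1Sign2.AnalyticMuZeroAtTwo` (cell
bsd-f1-sign2's OPEN crux IMC-K2μ, «open in print») is NOT asserted. This file TYPES the two new pieces of the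
ported chain as `Prop`s (`BridgeAtTwoLevel` = the ℓ-Hecke bridge at `2` with doubled conclusion; `CollapseAtTwo` =
`CollapseThree.core` run with `X' = 2[·]⁺`) and PROVES, sorry-free, the compositions
`BridgeAtTwoLevel → (good at 2, E[2] irreducible ⇒ DoubledWindingOddAtTwo W)` (THEOREM B supplies the span at
every odd level — a TREE THEOREM, `EvenBranch.theoremB`, valid at the prime `2`) and
`BridgeAtTwoLevel → CollapseAtTwo → F1Sign2.AnalyticMuZeroAtTwo` (the even-branch step at `2` is the TREE THEOREM
`AlignedTransportAtTwoMuCertificate.red_ne_zero_of_half_odd_msdMeasure`). USE: `F1Sign2.AnalyticMuZeroAtTwo` is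
the open input of line `kato-free-lower-sandwich-two`'s load-bearing stub `stub_muNonposOfNoRationalTwoTorsion`
(irreducible branch of K4); the plateau/reducible stub is NOT touched (no odd `a_ℓ` exists when `E[2]` is reducible).
-/

set_option linter.dupNamespace false
set_option autoImplicit false

noncomputable section

namespace Summit.BirchSwinnertonDyer.BirchSwinnertonDyer.Cruxes.OrdMissingLowerBoundAtTwo.OddWindingClassAtTwo

open scoped Classical MatrixGroups ModularForm
open CongruenceSubgroup Matrix Matrix.SpecialLinearGroup WeierstrassCurve
  Literature.NumberTheory.EllipticCurves Literature.NumberTheory.EllipticCurves.ModularForms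
  Literature.NumberTheory.EllipticCurves.Greenberg1999
  Literature.NumberTheory.EllipticCurves.Rank1Residual
  Summit.BirchSwinnertonDyer.Rank1Residual.X1.MuLambda
  Summit.BirchSwinnertonDyer.Rank1Residual.F1Sign2
  Summit.BirchSwinnertonDyer.BirchSwinnertonDyer.Theorems

/-! ## §0 The two currencies at `2` -/

/-- **(B2)-currency `DoubledWindingOddAtTwo W`**: for every newform `f` of `W`, the DOUBLED rational plus symbol
`2[·]⁺_f` (values in `ℤ₍₂₎` when `E[2]` is irreducible) is NON-CONSTANT MOD `2` on some `2`-power layer: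
some `2([a/2ⁿ]⁺ − [a'/2ⁿ]⁺)` is a `2`-adic unit, i.e. the closed winding class `{a'/2ⁿ → a/2ⁿ}` has ODD period
index `2 re{·}_f/Ω⁺_f`. (The undoubled carrier `CycWindingNonConstantAt W 2` only says `v₂ ≤ 0` of a
half-integer and is too weak at `2` — bsd-f3-mu MEMO-an §13.3 (C7).) A predicate; nothing asserted.
[cite: MazurTateTeitelbaum1986Invent, §I.10 (10.1)] -/
def DoubledWindingOddAtTwo (W : WeierstrassCurve ℚ) [W.IsGloballyMinimal] : Prop :=
  ∀ ⦃N : ℕ⦄ [NeZero N] (f : CuspForm (Gamma0 N) 2), IsNewformOf W f →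
    ∃ (n : ℕ) (a a' : ℤ),
      1 ≤ ‖((2 * (ratPlusSymbol f ((a : ℚ) / (2 : ℚ) ^ n) - ratPlusSymbol f ((a' : ℚ) / (2 : ℚ) ^ n)) : ℚ) :
        ℚ_[2])‖

/-- **(E2)-input currency `HalfOddMeasureValueAtTwo W`**: for every newform `f` of `W`, SOME value of the
Mazur–Swinnerton-Dyer measure `μ_{f,α}` (`α` = unit root at `2`) on a class `5^{s₀} mod 2^{n+2}` of `Γ = 1 + 4ℤ₂`
is a genuine half-integer (norm `> 1`) — exactly the hypothesis of the tree's `μ = 0` certificate at `2`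
`AlignedTransportAtTwoMuCertificate.red_ne_zero_of_half_odd_msdMeasure`. A predicate; nothing asserted.
[cite: MazurTateTeitelbaum1986Invent, §I.11–I.13] -/
def HalfOddMeasureValueAtTwo (W : WeierstrassCurve ℚ) [W.IsGloballyMinimal] : Prop :=
  ∀ ⦃N : ℕ⦄ [NeZero N] (f : CuspForm (Gamma0 N) 2), IsNewformOf W f →
    ∃ (n : ℕ) (s₀ : ZMod (2 ^ n)),
      1 < ‖msdMeasure f (unitRoot W 2 : ℚ_[2]) (n + 2) ((cyclotomicGenerator 2 : ZMod (2 ^ (n + 2))) ^ s₀.val)‖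

/-! ## §1 The two NEW pieces of the ported chain, typed (the line's stubs) -/

/-- **FIRST LEMMA (stub 1) `BridgeAtTwoLevel` — the ℓ-Hecke / vertical Stevens bridge AT `2`, DOUBLED conclusion.**
VERBATIM `PrintX8VerticalStevens.exists_mem_one_le_norm_sub_of_spanModBy_of_prime` with `p = 2` and the
conclusion `1 ≤ ‖2([γ·0]⁺ − [0]⁺)‖₂` («the period index `m(γ)` is ODD») in place of `1 ≤ ‖[γ·0]⁺ − [0]⁺‖_p`: the
`p`-odd proof derives exactly `∃ γ ∈ S, p ∤ m(γ)` (steps `hker`/`hall`, final `not_forall_dvd_of_realPeriods`,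
all `p`-agnostic) and uses `p ≠ 2` ONLY in `dvd_of_norm_div_two_lt_one` to read `p ∣ m` off `‖m/2‖_p < 1`;
with the doubled symbol one reads `2 ∣ m` off `‖m‖₂ < 1` (`Padic.norm_intCast_lt_one_iff`). Plausibly ~250
lines of kernel text adapted. Why it might fail: it should not — unless a hidden use of `‖2‖_p = 1` sits in the
symbol identities `hsub`/`h0` (to be checked line by line). [cite: Manin1972, Prop. 1.4, Thm. 1.9]
[cite: MazurTateTeitelbaum1986Invent, §I.10 (10.1)] -/
def BridgeAtTwoLevel : Prop :=
  ∀ ⦃N : ℕ⦄ [NeZero N] (f : CuspForm (Gamma0 N) 2), IsNewform0 f → coeffField f = ⊥ →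
    ∀ ⦃ℓ : ℕ⦄ [Fact ℓ.Prime], ¬ ℓ ∣ N → ∀ (aℓ : ℤ), cuspCoeff f ℓ = aℓ → ¬ (2 : ℤ) ∣ aℓ - (ℓ + 1) →
    ∀ (S : Set (Gamma0 N)), SpanModBy N 2 S →
      ∃ γ ∈ S, 1 ≤ ‖((2 * (ratPlusSymbol f ((((γ : SL(2, ℤ)) 0 1 : ℤ) : ℚ) / (((γ : SL(2, ℤ)) 1 1 : ℤ) : ℚ)) -
        ratPlusSymbol f 0) : ℚ) : ℚ_[2])‖

/-- **Stub 2 `CollapseAtTwo` — the `±`/layer collapse AT `2` with the doubled symbol.** `CollapseThree.core` is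
stated for an ABSTRACT periodic `X : ℚ → ℚ_[p]` and has no `p ≠ 2`; run it with `X' r = 2[r]⁺_f` (in `ℤ₂` at every
`r` with denominator prime to `N` once `E[2]` is irreducible: odd Eisenstein multiple `n₀ = 1 + ℓ − a_ℓ`,
`norm_ratPlusSymbol_two_le_two`), `α` the unit root: `hHecke` is the `T₂`-relation doubled, and the contrapositive
of `core` turns «`2[·]⁺` non-constant mod `2` on a layer» (`DoubledWindingOddAtTwo`) into «some
`2α^{n+1}μ(m + 2^{n+1}ℤ₂)`, `m` odd, is a unit», i.e. a HALF-ODD measure value; `m ≡ ±5^{s}` and evenness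
`msdMeasure_neg` put it on a class `5^{s₀} mod 2^{n'+2}` (the level-`1` class `1 + 2ℤ₂` is excluded by the bound
`norm_msdMeasure_two_le_two`: `μ(1+2ℤ₂) = 2μ(1+4ℤ₂)` has norm `≤ 1`). Why it might fail: bookkeeping of the
anomalous case `α ≡ 1 (mod 2)` (ALWAYS the case at `2`) — but `core`'s `L2`/`K`-steps handle `α ≡ 1` at odd `p`
already. [cite: MazurTateTeitelbaum1986Invent, §I.10 (10.1)–(10.4), §I.12] [cite: GreenbergVatsal2000, Prop. 3.7] -/
def CollapseAtTwo : Prop :=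
  ∀ (W : WeierstrassCurve ℚ) [W.IsElliptic] [W.IsGloballyMinimal],
    IsOrdinaryAt W 2 → (∀ x : ℚ, ¬ HasRationalTwoTorsionX W x) →
      DoubledWindingOddAtTwo W → HalfOddMeasureValueAtTwo W

/-! ## §2 PROVED compositions: THEOREM B at the prime `2` feeds the bridge; the tree's `μ`-certificate at `2` ends it -/

/-- **THEOREM B at `2` + the bridge at `2` ⟹ `DoubledWindingOddAtTwo W`** for `W` good at `2` with `E[2]`
irreducible. THEOREM B (`EvenBranch.theoremB : ∀ N p, p.Prime → ¬ p ∣ N → ConjSpanGen N p`) is a TREE THEOREM and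
ALLOWS `p = 2`; the Hecke witness `ℓ ≠ 2` good with `a_ℓ ≢ ℓ + 1 (mod 2)` (i.e. `a_ℓ` odd) comes from the tree
theorem `not_irreducible_of_frobeniusTrace_congr_holds` (Chebotarev + Brauer–Nesbitt, all `p`). PROVED modulo the
displayed `hB`. [cite: Manin1972, Prop. 1.4] -/
theorem doubledWindingOddAtTwo_of_bridge (hB : BridgeAtTwoLevel) (W : WeierstrassCurve ℚ) [W.IsElliptic]
    [W.IsGloballyMinimal] (hgood : W.HasGoodReductionAtPrime 2) (hirr : W.HasIrreducibleModPGaloisRep 2) :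
    DoubledWindingOddAtTwo W := by
  intro M _ f hf
  have h2M : ¬ 2 ∣ M := not_dvd_level_of_isNewformOf hf hgood
  obtain ⟨ℓ, _, -, hgoodℓ, hℓ1⟩ :=
    exists_prime_not_dvd_frobeniusTrace_sub not_irreducible_of_frobeniusTrace_congr_holds W 2 hirr
  have hℓM : ¬ ℓ ∣ M := not_dvd_level_of_isNewformOf hf hgoodℓ
  have hspan : SpanModBy M 2 {γ : Gamma0 M | IsGoodAt 2 γ} :=
    (spanModBy_setOf_isGoodAt_iff M 2).mpr (eisSpanModGen_of_eisSpanGen Nat.prime_two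
      (eisSpanGen_of_conjSpanGen (by decide)
        (Summit.BirchSwinnertonDyer.BirchSwinnertonDyer.Rank1Residual.EvenBranch.theoremB M 2 Nat.prime_two h2M)))
  obtain ⟨γ, ⟨k, hk⟩, hunit⟩ := hB f hf.1 hf.coeffField_eq_bot hℓM (W.frobeniusTrace ℓ)
    (cuspCoeff_eq_frobeniusTrace_of_isNewformOf_holds hf hgoodℓ) hℓ1 {γ : Gamma0 M | IsGoodAt 2 γ} hspan
  have hd : ((γ : SL(2, ℤ)) 1 1 : ℤ) = (2 : ℤ) ^ k ∨ ((γ : SL(2, ℤ)) 1 1 : ℤ) = -((2 : ℤ) ^ k) := by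
    have := Int.natAbs_eq_iff.mp hk
    push_cast at this
    simpa [dEntry] using this
  have h0 : ((0 : ℤ) : ℚ) / (2 : ℚ) ^ k = 0 := by simp
  rcases hd with hd | hd
  · refine ⟨k, ((γ : SL(2, ℤ)) 0 1 : ℤ), 0, ?_⟩
    have e : (((γ : SL(2, ℤ)) 0 1 : ℤ) : ℚ) / (2 : ℚ) ^ k =
        (((γ : SL(2, ℤ)) 0 1 : ℤ) : ℚ) / (((γ : SL(2, ℤ)) 1 1 : ℤ) : ℚ) := by
      rw [hd]; push_cast; rfl
    rw [h0, e]
    exact hunit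
  · refine ⟨k, -((γ : SL(2, ℤ)) 0 1 : ℤ), 0, ?_⟩
    have e : (((-((γ : SL(2, ℤ)) 0 1 : ℤ) : ℤ)) : ℚ) / (2 : ℚ) ^ k =
        (((γ : SL(2, ℤ)) 0 1 : ℤ) : ℚ) / (((γ : SL(2, ℤ)) 1 1 : ℤ) : ℚ) := by
      rw [hd]; push_cast; rw [div_neg, neg_div]
    rw [h0, e]
    exact hunit

/-- **The even-branch step at `2` is a TREE THEOREM**: a half-odd measure value on a class of `Γ` for every
good-ordinary `W` with `E(ℚ)[2] = 0` ⟹ `F1Sign2.AnalyticMuZeroAtTwo` BY NAME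
(`red_ne_zero_of_half_odd_msdMeasure`, via the `Γ`-half distribution). PROVED modulo the displayed `h`.
[cite: MazurTateTeitelbaum1986Invent, §I.11–I.13] -/
theorem analyticMuZeroAtTwo_of_halfOdd
    (h : ∀ (W : WeierstrassCurve ℚ) [W.IsElliptic] [W.IsGloballyMinimal],
      IsOrdinaryAt W 2 → (∀ x : ℚ, ¬ HasRationalTwoTorsionX W x) → HalfOddMeasureValueAtTwo W) :
    AnalyticMuZeroAtTwo := by
  intro W _ _ hord ht N _ f hf G hG
  obtain ⟨n, s₀, hs₀⟩ := h W hord ht f hf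
  have hlift : IsEvenBranchLiftAtTwo W f G := by
    unfold IsEvenBranchLiftAtTwo
    exact Or.inl ⟨hord, hG⟩
  exact AlignedTransportAtTwoMuCertificate.red_ne_zero_of_half_odd_msdMeasure W hord ht hf hs₀ hlift

/-- **THE PORTED CHAIN, closed BY NAME on cell bsd-f1-sign2's open crux**: bridge at `2` + collapse at `2` ⟹
`F1Sign2.AnalyticMuZeroAtTwo` (analytic `μ₂ = 0` for every good-ordinary `E/ℚ` with `E(ℚ)[2] = 0`). THEOREM B
and the `μ`-certificate are tree theorems; `E(ℚ)[2] = 0 ⇒ E[2]` irreducible is the tree's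
`AlignedTransportAtTwoClosure.irr_two_of_forall_not_hasRationalTwoTorsionX`. PROVED modulo `hB`, `hC`;
nothing about any curve is asserted; BSD is not proved. [cite: Greenberg1999, Conj. 1.11] -/
theorem analyticMuZeroAtTwo_of_chain (hB : BridgeAtTwoLevel) (hC : CollapseAtTwo) : AnalyticMuZeroAtTwo :=
  analyticMuZeroAtTwo_of_halfOdd fun W _ _ hord ht ↦
    hC W hord ht (doubledWindingOddAtTwo_of_bridge hB W hord.1
      (AlignedTransportAtTwoClosure.irr_two_of_forall_not_hasRationalTwoTorsionX W ht))


open Summit.BirchSwinnertonDyer.Rank1Residual.X5.O1 Summit.BirchSwinnertonDyer.Rank1Residual.X5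
  Summit.BirchSwinnertonDyer.BirchSwinnertonDyer.Theorems.IsogenyMuShift
  Summit.BirchSwinnertonDyer.Rank1Residual

/-! ## §4 Supply certificate for line `kato-free-lower-sandwich-two` (L1), irreducible branch

`AnalyticMuNonpos` below is copied VERBATIM from `Lines/kato_free_lower_sandwich_two.lean` (crux-dir modules are
not importable); `muNonposOfNoRationalTwoTorsion_of_chain` has exactly the type of L1's load-bearing stub
`stub_muNonposOfNoRationalTwoTorsion` behind three hypotheses: PRINT (Abbes–Ullmo at `2`, named fact
`realPeriodRat_eq_unit_mul_plusPeriod_two`), `BridgeAtTwoLevel`, `CollapseAtTwo`.  Proof = `irreducibleSupply_holds`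
of SketchKatoFreeSandwichTwo §A.4 (re-proved here) ∘ `analyticMuZeroAtTwo_of_chain`.  Nothing here proves BSD. -/

/-- (copy of L1's decl) **`μ_an^{Nér}(E) ≤ 0`** in slack form: for the newform `f`, the Néron ratio `ϖ`
(`ϖ·Ω_E = Ω⁺_f`) and every INTEGRAL `2`-power multiple `ι L₀ = 2ʲ·ϖ·L₂(f,α)`, `μ(L₀) ≤ j`. -/
def AnalyticMuNonpos (W : WeierstrassCurve ℚ) [W.IsElliptic] [W.IsGloballyMinimal] : Prop :=
  ∀ [NeZero (W.conductorNorm ℤ)] (f : CuspForm (Gamma0 (W.conductorNorm ℤ)) 2), IsNewformOf W f →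
    ∀ (ϖ : ℚ), (ϖ : ℝ) * W.realPeriodRat = plusPeriod f →
    ∀ (j : ℕ) (L₀ : IwasawaAlgebra 2),
      iwasawaToPowerSeries 2 L₀ =
        PowerSeries.C (((2 : ℚ) ^ j * ϖ : ℚ) : ℚ_[2]) * padicLFunction f (unitRoot W 2 : ℚ_[2]) →
      mu L₀ ≤ j

/-- **Irreducible-locus supply** (SketchKatoFreeSandwichTwo §A.4, re-proved): Abbes–Ullmo at `2` + `μ(L₂(f,α)) = 0`
give `AnalyticMuNonpos W` at every good-ordinary `W` with `E[2]` irreducible and no rational `2`-torsion. -/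
theorem analyticMuNonpos_of_analyticMuZeroAtTwo
    (hAU : realPeriodRat_eq_unit_mul_plusPeriod_two) (hAμ : AnalyticMuZeroAtTwo)
    (W : WeierstrassCurve ℚ) [W.IsElliptic] [W.IsGloballyMinimal]
    (hord : IsOrdinaryAt W 2) (hirr : W.HasIrreducibleModPGaloisRep 2)
    (h2 : ∀ x : ℚ, ¬ HasRationalTwoTorsionX W x) : AnalyticMuNonpos W := by
  intro _ f hf ϖ hϖ j L₀ hL₀
  obtain ⟨u, hu, hΩ⟩ := hAU W hord.1 hirr f hf
  have hϖv : padicValRat 2 ϖ = 0 :=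
    Rank1Residual.padicValRat_periodRatio_eq_zero_of_eq_unit_mul W 2 f hu hΩ ϖ hϖ
  have hϖ0 : ϖ ≠ 0 := by
    rintro rfl
    have hper : 0 < plusPeriod f := IsNewform0.plusPeriod_pos_holds hf.1 hf.coeffField_eq_bot
    rw [← hϖ, Rat.cast_zero, zero_mul] at hper
    exact lt_irrefl _ hper
  have hnorm : ‖(ϖ : ℚ_[2])‖ = 1 := by
    rw [Padic.eq_padicNorm, padicNorm.eq_zpow_of_nonzero hϖ0, hϖv, neg_zero, zpow_zero, Rat.cast_one]
  have hvc : ((PadicInt.mkUnits hnorm : ℤ_[2]ˣ) : ℤ_[2]) = (⟨(ϖ : ℚ_[2]), hnorm.le⟩ : ℤ_[2]) := by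
    simp [PadicInt.mkUnits]
  have hvc' : (((PadicInt.mkUnits hnorm : ℤ_[2]ˣ) : ℤ_[2]) : ℚ_[2]) = (ϖ : ℚ_[2]) := by
    rw [hvc]
  obtain ⟨G, hG⟩ := exists_integral_mul_padicLFunction_two_of_padicValRat_nonneg (W := W) hord hf
    (ϖ := 1) (by simp)
  have hG' : iwasawaToPowerSeries 2 G = padicLFunction f (unitRoot W 2 : ℚ_[2]) := by
    rw [hG, Rat.cast_one, map_one, one_mul]
  have hred : red G ≠ 0 := hAμ W hord h2 f hf G hG'
  have hred₁ : red (PowerSeries.C ((PadicInt.mkUnits hnorm : ℤ_[2]ˣ) : ℤ_[2]) * G) ≠ 0 :=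
    red_C_mul_ne_zero_of_isUnit (PadicInt.mkUnits hnorm).isUnit hred
  have hG₁0 : PowerSeries.C ((PadicInt.mkUnits hnorm : ℤ_[2]ˣ) : ℤ_[2]) * G ≠ 0 := by
    intro h0; rw [h0] at hred₁; exact hred₁ (by simp [red])
  have hμ₁ : mu (PowerSeries.C ((PadicInt.mkUnits hnorm : ℤ_[2]ˣ) : ℤ_[2]) * G) = 0 :=
    (mu_eq_and_pfree_eq hred₁ (by rw [pow_zero, map_one, one_mul])).1
  have hL₀eq : L₀ = PowerSeries.C (((2 : ℕ) : ℤ_[2]) ^ j) *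
      (PowerSeries.C ((PadicInt.mkUnits hnorm : ℤ_[2]ˣ) : ℤ_[2]) * G) := by
    have h2c : ((2 : ℤ_[2]) : ℚ_[2]) = 2 := by simpa using (PadicInt.coe_natCast (p := 2) 2)
    apply iwasawaToPowerSeries_injective (p := 2)
    rw [hL₀, ← hG', map_mul, map_mul, iwasawaToPowerSeries_C, iwasawaToPowerSeries_C, ← mul_assoc,
      ← map_mul, hvc']
    push_cast
    rw [h2c]
  rw [hL₀eq, mu_C_pow_mul hG₁0 j, hμ₁, add_zero]

/-- **SUPPLY CERTIFICATE.**  Abbes–Ullmo at `2` + `BridgeAtTwoLevel` + `CollapseAtTwo` ⟹ the statement of L1's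
`stub_muNonposOfNoRationalTwoTorsion` VERBATIM (its `¬CM` and `rank_an = 0` binders are not even used). -/
theorem muNonposOfNoRationalTwoTorsion_of_chain
    (hAU : realPeriodRat_eq_unit_mul_plusPeriod_two) (hB : BridgeAtTwoLevel) (hC : CollapseAtTwo) :
    ∀ (W : WeierstrassCurve ℚ) [W.IsElliptic] [W.IsGloballyMinimal],
      ¬ W.HasCM → W.analyticRank = 0 → GoodOrd W 2 → (∀ x : ℚ, ¬ HasRationalTwoTorsionX W x) →
      AnalyticMuNonpos W := by
  intro W _ _ _ _ hgo ht _ f hf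
  have hord : IsOrdinaryAt W 2 := (isOrdinaryAt_iff W 2).2 ⟨hgo.1, hgo.2⟩
  exact analyticMuNonpos_of_analyticMuZeroAtTwo hAU (analyticMuZeroAtTwo_of_chain hB hC) W hord
    (AlignedTransportAtTwoClosure.irr_two_of_forall_not_hasRationalTwoTorsionX W ht) ht f hf

end Summit.BirchSwinnertonDyer.BirchSwinnertonDyer.Cruxes.OrdMissingLowerBoundAtTwo.OddWindingClassAtTwo

end
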